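import Literature.Probability.RandomPlanarGeometry.HexSAWIrreducibleBridges
import HarnessLib

/-!
# Bridges of the hexagonal lattice counted by LENGTH in the Duminil-Copin–Smirnov strip frame

Topic `Literature/Probability/RandomPlanarGeometry` (continues `HexSAWIrreducibleBridges.lean`).  Sources: H. Duminil-Copin,
S. Smirnov, *The connective constant of the honeycomb lattice equals `√(2+√2)`*, Ann. of Math. 175 (2012), §3 (the strips
`S_T`, their finite versions `S_{T,L}` and the walks `a → β`, "bridges", of the tree's `HV.bridgeLists T L`); H. Kesten,
*On the number of self-avoiding walks*, J. Math. Phys. 4 (1963), §4 and N. Madras, G. Slade, *The Self-Avoiding Walk*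
(1993), Definition 1.2.4 / Definition 4.2.1 (bridges `b_n` and irreducible bridges `λ_n` counted by the number of steps);
the length-`2` values are the two one-edge bridges of `S_1` [DuminilCopinSmirnov2012, §3, "`B_1 ≥ x²`" shape of the
tree's `HV.sq_le_stripB_one`].

The tree's strip machinery grades bridges by WIDTH `T` inside a finite box `S_{T,L}`.  This file sets up the grading by
LENGTH (number of vertices `n`), summed over all widths, which is the grading of Kesten's renewal `b_n = Σ λ_k b_{n-k}`:

* `hvBridgeLen n = b_n(ℍ)` — bridges with `n` vertices (all widths `T ≤ n`, box `L = n`); `hvIrrLen n = λ_n(ℍ)` —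
  the irreducible ones (no break level); `hvU`, `hvF` — the half-length renewal pair `u_m = b_{2m} x_c^{2m}`,
  `f_k = λ_{2k} x_c^{2k}`; `hvMass`, `hvR` — partial sums `Σ_{m ≤ M} u_m` and tails `1 − Σ_{k ≤ j} f_k`.
* BOX STABILITY (`filter_length_bridgeLists_eq`, `filter_length_irrLists_eq`): a bridge with at most `L` vertices of
  some `S_{T,L'}` already lies in `S_{T,L}` — the first coordinate moves by at most one per step
(`abs_fst_sub_le_of_isChain`, from the tree's `HV.abs_sub_le_one_of_adj`) — so the length-`n` counts do not depend on the box once `L ≥ n`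
  (`hvBridgeLen_eq_sum`, `hvIrrLen_eq_sum`).
* `two_mul_le_length_of_mem_bridgeLists'` — length `≥ 2·width`; `hvBridgeLen_odd`, `hvIrrLen_odd` — bridges have an
  even number of vertices (parity of levels along a chain); `hvIrrLen_le` — `λ_n ≤ b_n`.
* `hvBridgeLen_two`, `hvIrrLen_two` — `b_2 = λ_2 = 2` (the aperiodicity input `f_1 = 2 x_c² > 0` of the renewal
  theorem by length).

Sanity values (plain enumeration in the coordinate model, informational): `b_n = 2, 6, 18, 54, 170, 542, 1740, 5626` and
`λ_n = 2, 2, 2, 2, 10, 26, 60, 158` for `n = 2, 4, …, 16`; `b_n = λ_n = 0` for odd `n`.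
-/

noncomputable section

open Finset Literature.Probability.LatticeModels

namespace Literature.Probability.RandomPlanarGeometry.SAW

open HV

/-! ### The objects -/

open Classical in
/-- `b_n(ℍ)` in the DCS frame: the number of bridges of LENGTH `n` (vertices) of the strips `S_T`, summed over the widths
`T = 1, …, n` (a bridge with `n` vertices lies in `S_{T,n}`). [cite: DuminilCopinSmirnov2012, §3; MadrasSlade1993, Definition 1.2.4] -/
def hvBridgeLen (n : ℕ) : ℕ := ∑ T ∈ Icc 1 n, #((bridgeLists T n).filter fun l => l.length = n)

open Classical in
/-- `λ_n(ℍ)` in the DCS frame: the number of IRREDUCIBLE bridges (no break level) of length `n`, summed over the widths.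
[cite: Kesten1963SAW, §4; MadrasSlade1993, Definition 4.2.1] -/
def hvIrrLen (n : ℕ) : ℕ := ∑ T ∈ Icc 1 n, #((irrLists T n).filter fun l => l.length = n)

/-- The renewal sequence by HALF-LENGTH, `u_m = b_{2m} x_c^{2m}` (`u_0 = 1`). [cite: MadrasSlade1993, §4.2, p. 91] -/
def hvU (m : ℕ) : ℝ := if m = 0 then 1 else (hvBridgeLen (2 * m) : ℝ) * hexCriticalFugacity ^ (2 * m)

/-- The inter-renewal law by half-length, `f_k = λ_{2k} x_c^{2k}` (`f_0 = 0`). [cite: MadrasSlade1993, §4.2, p. 91] -/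
def hvF (k : ℕ) : ℝ := (hvIrrLen (2 * k) : ℝ) * hexCriticalFugacity ^ (2 * k)

/-- `U_M := Σ_{m ≤ M} u_m = Σ_{m ≤ M} b_{2m} x_c^{2m}` (`u_0 = 1`). [cite: MadrasSlade1993, §4.2] -/
def hvMass (M : ℕ) : ℝ := ∑ m ∈ range (M + 1), hvU m

/-- `r_j := 1 − Σ_{k ≤ j} f_k` — the tail `P(ℓ/2 > j)` of the irreducible-bridge half-length law once `Σ f = 1`.
[cite: MadrasSlade1993, Appendix B, (B.5)] -/
def hvR (j : ℕ) : ℝ := 1 - ∑ k ∈ range (j + 1), hvF k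

/-! ### Basic values and signs -/

/-- `b_0 = 0` (no bridge without vertices). [cite: MadrasSlade1993, Definition 1.2.4] -/
@[simp] theorem hvBridgeLen_zero : hvBridgeLen 0 = 0 := by simp [hvBridgeLen]

/-- `λ_0 = 0`. [cite: MadrasSlade1993, Definition 4.2.1] -/
@[simp] theorem hvIrrLen_zero : hvIrrLen 0 = 0 := by simp [hvIrrLen]

/-- `f_0 = 0` (hypothesis of the renewal theorem). [cite: MadrasSlade1993, Theorem 4.2.2 (hypotheses `f_0 = 0`, `u_0 = 1`, `f_k ≥ 0`)] -/
theorem hvF_zero : hvF 0 = 0 := by simp [hvF, hvIrrLen]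

/-- `f_k ≥ 0` (hypothesis of the renewal theorem). [cite: MadrasSlade1993, Theorem 4.2.2] -/
theorem hvF_nonneg (k : ℕ) : 0 ≤ hvF k :=
  mul_nonneg (Nat.cast_nonneg _) (pow_nonneg hexCriticalFugacity_pos_lt_one.1.le _)

/-- `u_0 = 1` (hypothesis of the renewal theorem). [cite: MadrasSlade1993, Theorem 4.2.2] -/
theorem hvU_zero : hvU 0 = 1 := by simp [hvU]

/-- `u_m = b_{2m} x_c^{2m}` for `m ≠ 0`. [cite: MadrasSlade1993, §4.2, p. 91 (`b_N/μ^N` as a renewal sequence)] -/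
theorem hvU_of_ne {m : ℕ} (hm : m ≠ 0) : hvU m = (hvBridgeLen (2 * m) : ℝ) * hexCriticalFugacity ^ (2 * m) := by
  simp [hvU, hm]

/-- `u_m ≥ 0`. [cite: MadrasSlade1993, Theorem 4.2.2] -/
theorem hvU_nonneg (m : ℕ) : 0 ≤ hvU m := by
  rcases eq_or_ne m 0 with rfl | hm
  · simp [hvU]
  · rw [hvU_of_ne hm]; exact mul_nonneg (Nat.cast_nonneg _) (pow_nonneg hexCriticalFugacity_pos_lt_one.1.le _)

/-! ### Length versus width, parity -/

/-- Along an `hvGraph`-chain the level changes by `±1` per step (`HV.lev_eq_of_adj`), so the last vertex sits at most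
`length − 1` levels above the first. [folklore] -/
private theorem lev_getLast_le_of_isChain : ∀ {l : List HV} (_ : l.IsChain hvGraph.Adj) (hne : l ≠ []),
    lev (l.getLast hne) ≤ lev (l.head hne) + ((l.length : ℤ) - 1)
  | [], _, hne => (hne rfl).elim
  | [v], _, _ => by simp
  | v :: w :: t, hc, _ => by
      obtain ⟨hvw, hc'⟩ := List.isChain_cons_cons.1 hc
      have ih := lev_getLast_le_of_isChain hc' (List.cons_ne_nil w t)
      rw [List.getLast_cons (List.cons_ne_nil w t)]
      have h1 : lev w ≤ lev v + 1 := by rcases lev_eq_of_adj hvw with h | h <;> omega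
      simp only [List.head_cons, List.length_cons, Nat.cast_add, Nat.cast_one] at ih ⊢
      omega

/-- A bridge of width `T` ends on level `2T − 1` and starts at `O` (level `0`), so it has at least `2T` vertices:
**length ≥ twice the width**. [cite: DuminilCopinSmirnov2012, §3 (bridges of `S_T`)] -/
theorem two_mul_le_length_of_mem_bridgeLists' {T L : ℕ} (hT : 1 ≤ T) {l : List HV} (hl : l ∈ bridgeLists T L) :
    2 * T ≤ l.length := by
  obtain ⟨hc, hh, -, -, hne, hlast⟩ := (mem_bridgeLists_iff hT).1 hl
  have hhead : l.head hne = hvOrigin := by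
    rw [List.head?_eq_some_head hne] at hh; exact Option.some_injective _ hh
  have h := lev_getLast_le_of_isChain hc hne
  rw [hlast, hhead, lev_hvOrigin] at h
  omega

/-- Widths `T` with `2T > n` carry no bridge of length `n`. [cite: DuminilCopinSmirnov2012, §3] -/
theorem filter_length_bridgeLists_eq_empty {T L n : ℕ} (hT : 1 ≤ T) (h : n < 2 * T) :
    ((bridgeLists T L).filter fun l => l.length = n) = ∅ := by
  refine filter_eq_empty_iff.2 fun l hl hlen => ?_
  have := two_mul_le_length_of_mem_bridgeLists' hT hl
  omega

/-- Widths `T` with `2T > n` carry no irreducible bridge of length `n`. [cite: Kesten1963SAW, §4] -/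
theorem filter_length_irrLists_eq_empty {T L n : ℕ} (hT : 1 ≤ T) (h : n < 2 * T) :
    ((irrLists T L).filter fun l => l.length = n) = ∅ := by
  refine filter_eq_empty_iff.2 fun l hl hlen => ?_
  rw [irrLists, mem_filter] at hl
  have := two_mul_le_length_of_mem_bridgeLists' hT hl.1
  omega

/-- Parity along an `hvGraph`-chain: `lev(last) − lev(head) + (length − 1)` is even (each step contributes `±1 + 1`).
[folklore] -/
private theorem even_lev_getLast_sub_of_isChain : ∀ {l : List HV} (_ : l.IsChain hvGraph.Adj) (hne : l ≠ []),
    ∃ k : ℤ, lev (l.getLast hne) - lev (l.head hne) + ((l.length : ℤ) - 1) = 2 * k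
  | [], _, hne => (hne rfl).elim
  | [v], _, _ => ⟨0, by simp⟩
  | v :: w :: t, hc, _ => by
      obtain ⟨hvw, hc'⟩ := List.isChain_cons_cons.1 hc
      obtain ⟨k, hk⟩ := even_lev_getLast_sub_of_isChain hc' (List.cons_ne_nil w t)
      rw [List.getLast_cons (List.cons_ne_nil w t)]
      simp only [List.head_cons, List.length_cons, Nat.cast_add, Nat.cast_one] at hk ⊢
      rcases lev_eq_of_adj hvw with h | h
      · exact ⟨k + 1, by omega⟩
      · exact ⟨k, by omega⟩

/-- A bridge has an EVEN number of vertices (net level change `2T − 1`, steps `±1`): the length-`(2m+1)` fibres are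
empty. [cite: DuminilCopinSmirnov2012, §3] -/
theorem filter_length_bridgeLists_odd {T L : ℕ} (hT : 1 ≤ T) (m : ℕ) :
    ((bridgeLists T L).filter fun l => l.length = 2 * m + 1) = ∅ := by
  refine filter_eq_empty_iff.2 fun l hl hlen => ?_
  obtain ⟨hc, hh, -, -, hne, hlast⟩ := (mem_bridgeLists_iff hT).1 hl
  have hhead : l.head hne = hvOrigin := by
    rw [List.head?_eq_some_head hne] at hh; exact Option.some_injective _ hh
  obtain ⟨k, hk⟩ := even_lev_getLast_sub_of_isChain hc hne
  rw [hlast, hhead, lev_hvOrigin, hlen] at hk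
  push_cast at hk
  omega

/-- `b_{2m+1}(ℍ) = 0`. [cite: DuminilCopinSmirnov2012, §3] -/
theorem hvBridgeLen_odd (m : ℕ) : hvBridgeLen (2 * m + 1) = 0 := by
  unfold hvBridgeLen
  refine sum_eq_zero fun T hT => ?_
  rw [filter_length_bridgeLists_odd (mem_Icc.1 hT).1 m, card_empty]

/-- `λ_n(ℍ) ≤ b_n(ℍ)`. [cite: Kesten1963SAW, §4] -/
theorem hvIrrLen_le (n : ℕ) : hvIrrLen n ≤ hvBridgeLen n := by
  unfold hvIrrLen hvBridgeLen
  refine sum_le_sum fun T _ => card_le_card (filter_subset_filter _ ?_)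
  rw [irrLists]; exact filter_subset _ _

/-- `λ_{2m+1}(ℍ) = 0`. [cite: DuminilCopinSmirnov2012, §3] -/
theorem hvIrrLen_odd (m : ℕ) : hvIrrLen (2 * m + 1) = 0 :=
  Nat.eq_zero_of_le_zero ((hvIrrLen_le _).trans (hvBridgeLen_odd m).le)

/-! ### Box stability: the length-`n` counts do not see the box once `L ≥ n` -/

/-- Along an `hvGraph`-chain, every vertex is within `length − 1` of the first one in the first coordinate. [folklore] -/
private theorem abs_fst_sub_le_of_isChain : ∀ {l : List HV} (_ : l.IsChain hvGraph.Adj) (hne : l ≠ []) {v : HV} (_ : v ∈ l),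
    |v.1 - (l.head hne).1| ≤ (l.length : ℤ) - 1
  | [], _, hne, _, _ => (hne rfl).elim
  | [u], _, _, v, hv => by
      rw [List.mem_singleton] at hv
      subst hv
      simp
  | u :: w :: t, hc, _, v, hv => by
      obtain ⟨huw, hc'⟩ := List.isChain_cons_cons.1 hc
      simp only [List.head_cons, List.length_cons, Nat.cast_add, Nat.cast_one]
      rcases List.mem_cons.1 hv with rfl | hv'
      · simp only [sub_self, abs_zero]; omega
      · have ih := abs_fst_sub_le_of_isChain hc' (List.cons_ne_nil w t) hv'
        have h1 := (abs_sub_le_one_of_adj huw).1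
        simp only [List.head_cons, List.length_cons, Nat.cast_add, Nat.cast_one] at ih
        rw [abs_le] at ih h1 ⊢
        omega

/-- The type bit is `0` or `1`, in particular non-negative. [folklore] -/
private theorem bit_nonneg (v : HV) : 0 ≤ bit v := by
  unfold bit; split_ifs <;> norm_num

/-- **Box stability.**  A bridge of width `T` of some `S_{T,L'}` with at most `L` vertices is a bridge of `S_{T,L}`: its
first coordinates stay in `[-(L-1), L-1]`. [cite: DuminilCopinSmirnov2012, §3 (the finite strips `S_{T,L}`)] -/
theorem mem_bridgeLists_of_length_le {T L L' : ℕ} (hT : 1 ≤ T) {l : List HV} (hl : l ∈ bridgeLists T L')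
    (hlen : l.length ≤ L) : l ∈ bridgeLists T L := by
  obtain ⟨hc, hh, hnd, hV, hne, hlast⟩ := (mem_bridgeLists_iff hT).1 hl
  have hhead : l.head hne = hvOrigin := by
    rw [List.head?_eq_some_head hne] at hh; exact Option.some_injective _ hh
  refine (mem_bridgeLists_iff hT).2 ⟨hc, hh, hnd, fun x hx => ?_, hne, hlast⟩
  have hxV := hV x hx
  have hb := abs_fst_sub_le_of_isChain hc hne hx
  rw [hhead] at hb
  have hbit := bit_nonneg x
  have hlenZ : (l.length : ℤ) ≤ L := by exact_mod_cast hlen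
  rw [mem_stripV_iff] at hxV ⊢
  simp only [hvOrigin, sub_zero] at hb
  rw [abs_le] at hb
  omega

/-- **Box stability for the length fibres of `bridgeLists`**: for `n ≤ L` the bridges of width `T` with `n` vertices
are the same in `S_{T,L}` and in `S_{T,n}`. [cite: DuminilCopinSmirnov2012, §3] -/
theorem filter_length_bridgeLists_eq {T L n : ℕ} (hT : 1 ≤ T) (hn : n ≤ L) :
    ((bridgeLists T L).filter fun l => l.length = n) = (bridgeLists T n).filter fun l => l.length = n := by
  ext l
  simp only [mem_filter, and_congr_left_iff]
  intro hlen
  exact ⟨fun h => mem_bridgeLists_of_length_le hT h hlen.le, fun h => bridgeLists_mono_L hT hn h⟩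

/-- Box stability for `irrLists` (irreducibility does not see the box). [cite: Kesten1963SAW, §4] -/
theorem mem_irrLists_of_length_le {T L L' : ℕ} (hT : 1 ≤ T) {l : List HV} (hl : l ∈ irrLists T L')
    (hlen : l.length ≤ L) : l ∈ irrLists T L := by
  rw [irrLists, mem_filter] at hl ⊢
  exact ⟨mem_bridgeLists_of_length_le hT hl.1 hlen, hl.2⟩

/-- `irrLists` is increasing in the box parameter `L`. [cite: Kesten1963SAW, §4] -/
theorem irrLists_mono_L {T L L' : ℕ} (hT : 1 ≤ T) (h : L ≤ L') : irrLists T L ⊆ irrLists T L' := by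
  unfold irrLists
  exact filter_subset_filter _ (bridgeLists_mono_L hT h)

/-- **Box stability for the length fibres of `irrLists`**. [cite: Kesten1963SAW, §4] -/
theorem filter_length_irrLists_eq {T L n : ℕ} (hT : 1 ≤ T) (hn : n ≤ L) :
    ((irrLists T L).filter fun l => l.length = n) = (irrLists T n).filter fun l => l.length = n := by
  ext l
  simp only [mem_filter, and_congr_left_iff]
  intro hlen
  exact ⟨fun h => mem_irrLists_of_length_le hT h hlen.le, fun h => irrLists_mono_L hT hn h⟩

/-- `b_n(ℍ)` computed in any box `L ≥ n` and over any range of widths `[1, N]`, `N ≥ n` (the extra widths carry no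
bridge of length `n`). [cite: DuminilCopinSmirnov2012, §3] -/
theorem hvBridgeLen_eq_sum {n N L : ℕ} (hN : n ≤ 2 * N + 1) (hL : n ≤ L) :
    hvBridgeLen n = ∑ T ∈ Icc 1 N, #((bridgeLists T L).filter fun l => l.length = n) := by
  -- both sides equal the sum over the widths `T ≤ min n N`, the other widths carrying empty fibres
  have hvan : ∀ M T : ℕ, T ∈ Icc 1 M → T ∉ Icc 1 (min n N) →
      #((bridgeLists T L).filter fun l => l.length = n) = 0 := by
    intro M T hT hT'
    rw [mem_Icc] at hT
    have hnT : n < 2 * T := by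
      rw [mem_Icc, not_and_or, not_le, not_le] at hT'
      rcases hT' with h | h
      · omega
      · rcases min_lt_iff.1 h with h1 | h1 <;> omega
    rw [filter_length_bridgeLists_eq_empty hT.1 hnT, card_empty]
  unfold hvBridgeLen
  have h1 : ∑ T ∈ Icc 1 n, #((bridgeLists T n).filter fun l => l.length = n)
      = ∑ T ∈ Icc 1 n, #((bridgeLists T L).filter fun l => l.length = n) :=
    sum_congr rfl fun T hT => by rw [filter_length_bridgeLists_eq (mem_Icc.1 hT).1 hL]
  rw [h1, ← sum_subset (Icc_subset_Icc_right (min_le_left n N)) (hvan n),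
    ← sum_subset (Icc_subset_Icc_right (min_le_right n N)) (hvan N)]

/-- `λ_n(ℍ)` computed in any box `L ≥ n` and over any range of widths `[1, N]`, `N ≥ n`. [cite: Kesten1963SAW, §4] -/
theorem hvIrrLen_eq_sum {n N L : ℕ} (hN : n ≤ 2 * N + 1) (hL : n ≤ L) :
    hvIrrLen n = ∑ T ∈ Icc 1 N, #((irrLists T L).filter fun l => l.length = n) := by
  have hvan : ∀ M T : ℕ, T ∈ Icc 1 M → T ∉ Icc 1 (min n N) →
      #((irrLists T L).filter fun l => l.length = n) = 0 := by
    intro M T hT hT'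
    rw [mem_Icc] at hT
    have hnT : n < 2 * T := by
      rw [mem_Icc, not_and_or, not_le, not_le] at hT'
      rcases hT' with h | h
      · omega
      · rcases min_lt_iff.1 h with h1 | h1 <;> omega
    rw [filter_length_irrLists_eq_empty hT.1 hnT, card_empty]
  unfold hvIrrLen
  have h1 : ∑ T ∈ Icc 1 n, #((irrLists T n).filter fun l => l.length = n)
      = ∑ T ∈ Icc 1 n, #((irrLists T L).filter fun l => l.length = n) :=
    sum_congr rfl fun T hT => by rw [filter_length_irrLists_eq (mem_Icc.1 hT).1 hL]
  rw [h1, ← sum_subset (Icc_subset_Icc_right (min_le_left n N)) (hvan n),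
    ← sum_subset (Icc_subset_Icc_right (min_le_right n N)) (hvan N)]

/-! ### The two bridges of length two -/

/-- Irreducibility is vacuous in width one: `irrLists 1 L = bridgeLists 1 L`. [cite: Kesten1963SAW, §4] -/
theorem irrLists_one (L : ℕ) : irrLists 1 L = bridgeLists 1 L := by
  rw [irrLists]
  refine filter_true_of_mem fun l _ t ht1 ht2 => ?_
  omega

/-- The bridges with two vertices are `[O, (0,0,1)]` and `[O, (-1,0,1)]` (the two down-triangles above the origin at
level `1`; the third neighbour `(0,-1,1)` of `O` lies below level `0`). [cite: DuminilCopinSmirnov2012, §3] -/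
theorem filter_length_two_bridgeLists_one :
    ((bridgeLists 1 2).filter fun l => l.length = 2) = {[hvOrigin, (0, 0, true)], [hvOrigin, (-1, 0, true)]} := by
  ext l
  rw [mem_filter, mem_bridgeLists_iff le_rfl, mem_insert, mem_singleton]
  constructor
  · rintro ⟨⟨hc, hh, -, hV, hne, hlast⟩, hlen⟩
    match l, hlen with
    | [a, b], _ =>
      simp only [List.head?_cons, Option.some.injEq] at hh
      subst hh
      have hab : hvGraph.Adj hvOrigin b := (List.isChain_cons_cons.1 hc).1
      rw [hvGraph_adj_iff_mem_nbrs] at hab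
      simp only [List.getLast_cons_cons, List.getLast_singleton] at hlast
      simp only [hvOrigin, nbrs, List.mem_cons, List.not_mem_nil, or_false] at hab
      rcases hab with rfl | rfl | rfl
      · exact Or.inl rfl
      · exact Or.inr rfl
      · simp [lev] at hlast
  · rintro (rfl | rfl)
    · refine ⟨⟨?_, rfl, by decide, ?_, List.cons_ne_nil _ _, by decide⟩, rfl⟩
      · exact List.isChain_cons_cons.2 ⟨by decide, List.isChain_singleton _⟩
      · intro x hx
        simp only [List.mem_cons, List.not_mem_nil, or_false] at hx
        rcases hx with rfl | rfl <;> (rw [mem_stripV_iff]; decide)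
    · refine ⟨⟨?_, rfl, by decide, ?_, List.cons_ne_nil _ _, by decide⟩, rfl⟩
      · exact List.isChain_cons_cons.2 ⟨by decide, List.isChain_singleton _⟩
      · intro x hx
        simp only [List.mem_cons, List.not_mem_nil, or_false] at hx
        rcases hx with rfl | rfl <;> (rw [mem_stripV_iff]; decide)

/-- The two length-two bridges are distinct lists. [folklore] -/
private theorem card_lengthTwoPair :
    #(({[hvOrigin, (0, 0, true)], [hvOrigin, (-1, 0, true)]} : Finset (List HV))) = 2 :=
  card_pair (by simp [hvOrigin])

/- NOTE (kernel hygiene).  `bridgeLists T L` is a closed computable finset; any definitional unfolding of a CLOSED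
instance such as `#((bridgeLists 1 2).filter _) + #((bridgeLists 2 2).filter _)` makes the kernel's `Nat` arithmetic
try to evaluate the operands ("excessive memory").  The closed evaluations below therefore go through one-term sums
only (`N = 1` in `hvBridgeLen_eq_sum`) and explicit `Eq.trans` chains. -/

/-- `b_2(ℍ) = 2`. [cite: DuminilCopinSmirnov2012, §3] -/
theorem hvBridgeLen_two : hvBridgeLen 2 = 2 :=
  calc hvBridgeLen 2 = ∑ T ∈ Icc 1 1, #((bridgeLists T 2).filter fun l => l.length = 2) :=
        hvBridgeLen_eq_sum (by norm_num) le_rfl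
    _ = #((bridgeLists 1 2).filter fun l => l.length = 2) := by rw [Icc_self, sum_singleton]
    _ = 2 := by rw [filter_length_two_bridgeLists_one, card_lengthTwoPair]

/-- **`λ_2(ℍ) = 2`**: the two one-edge bridges of `S_1` are irreducible — the aperiodicity input `f_1 = 2x_c² > 0` of the
renewal theorem by length. [cite: DuminilCopinSmirnov2012, §3; Kesten1963SAW, §4] -/
theorem hvIrrLen_two : hvIrrLen 2 = 2 :=
  calc hvIrrLen 2 = ∑ T ∈ Icc 1 1, #((irrLists T 2).filter fun l => l.length = 2) :=
        hvIrrLen_eq_sum (by norm_num) le_rfl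
    _ = #((irrLists 1 2).filter fun l => l.length = 2) := by rw [Icc_self, sum_singleton]
    _ = 2 := by rw [irrLists_one, filter_length_two_bridgeLists_one, card_lengthTwoPair]

/-- `f_1 = 2 x_c² > 0`. [cite: DuminilCopinSmirnov2012, §3] -/
theorem hvF_one_pos : 0 < hvF 1 := by
  rw [hvF, show 2 * 1 = 2 from rfl, hvIrrLen_two]
  exact mul_pos (by norm_num) (pow_pos hexCriticalFugacity_pos_lt_one.1 _)

end Literature.Probability.RandomPlanarGeometry.SAW

end
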